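import Summits.QuantumFields.YangMills.Theorems.BrascampLiebVacuum.Negative.FalseWithoutLocality

/-!
# `ConvexGribovBody.BrascampLiebVacuumSC` — negative lane: a volume-uniform variance floor for the
# time-zero plaquette trace (refuter / standing disprover, crux stmt-QuantumFields-16404)

Support file for `Negative/DmaxFloor.lean` ("the crux forces a volume-uniform floor on its
covariance scale `Dmax`"). The admissible probe of the crux
`Summit.QuantumFields.YangMills.Theses.ConvexGribovBody.BrascampLiebVacuumSC` used there is the
time-zero origin plaquette trace `f(U) = Re tr ρ(U_p)`, and this file proves that its variance
under Wilson's measure on `(2S+1)⁴` is bounded BELOW by `v(β, G, r) > 0` UNIFORMLY IN THE VOLUME: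

* `exists_haar_sq_sub_ge` — one-link floor: `σ ≤ ∫ (Re tr ρ(a g) − m)² dg` for all `m, a`
  (`σ = Var_Haar(Re χ_r) > 0`: left invariance of Haar measure, `Re χ_r` continuous and not
  constant on a non-abelian `G` with faithful `r`, Haar charges open sets);
* `exists_wilsonAction_update_bound` — one-link LOCALITY of the Wilson action, uniform in the
  volume: `|S(U) − S(U[e ↦ g])| ≤ B(r)` (only the `≤ 64` plaquettes through `e` move, each by
  `≤ 2(N + M)`);
* `plaquette_variance_floor` — `Var_μ f ≥ e^{−2|β|B} σ` on every torus `S ≥ 1`: write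
  `dμ = Z⁻¹ e^{−βS} dU`, free the first link of the plaquette against `e^{±|β|B}`
  (`exp_mul_le_of_abs_sub_le`), integrate it first (Mathlib's iterated marginals `lmarginal` over
  product Haar measure) and use the one-link floor; the two comparison factors and `Z` cancel.

Elementary (no DLR / conditional expectations); everything proved, axioms `propext`,
`Classical.choice`, `Quot.sound`. Nothing here mentions a Theses statement.
-/

noncomputable section

open scoped BigOperators Topology Matrix ENNReal Matrix.Norms.Frobenius
open Filter MeasureTheory Function
open Literature.MathematicalPhysics.QuantumFieldTheory
open Summit.QuantumFields.YangMills.Theorems.BrascampLiebVacuum.Negative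

namespace Summit.QuantumFields.YangMills.Theorems.BrascampLiebVacuumSC.Negative

/-! ### One-link Haar variance floor -/

section Haar

variable {G : Type*} [Group G] [TopologicalSpace G] [IsTopologicalGroup G] [CompactSpace G]
  [MeasurableSpace G] [BorelSpace G]

/-- **Uniform one-link variance floor**: for a faithful unitary `r` of a compact simple `G` there is
`σ > 0` with `σ ≤ ∫ (Re tr ρ(a g) − m)² dg` for every constant `m` and every `a`. -/
theorem exists_haar_sq_sub_ge (hG : IsCompactSimpleLieGroup G) (r : LatticeRep G) :
    ∃ σ : ℝ, 0 < σ ∧ ∀ (m : ℝ) (a : G),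
      σ ≤ ∫ g, ((r.ρ (a * g)).trace.re - m) ^ 2 ∂haarProbability G := by
  set χ : G → ℝ := fun g => (r.ρ g).trace.re with hχ
  have hχc : Continuous χ := continuous_trace_re r.ρ r.continuous
  set cbar : ℝ := ∫ g, χ g ∂haarProbability G with hcbar
  refine ⟨∫ g, (χ g - cbar) ^ 2 ∂haarProbability G, ?_, fun m a => ?_⟩
  · obtain ⟨a, ha⟩ := exists_re_trace_lt hG r
    have hne : χ 1 ≠ χ a := by
      simp only [hχ, map_one, Matrix.trace_one, Fintype.card_fin, Complex.natCast_re]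
      exact ha.ne'
    exact integral_sq_sub_pos (haarProbability G) hχc hne cbar
  · -- left invariance removes `a`
    have h1 : ∫ g, ((r.ρ (a * g)).trace.re - m) ^ 2 ∂haarProbability G =
        ∫ g, (χ g - m) ^ 2 ∂haarProbability G :=
      integral_mul_left_eq_self (fun g => (χ g - m) ^ 2) a
    rw [h1]
    -- ∫ (χ - m)² = ∫ (χ - cbar)² + (cbar - m)²
    have hi1 : Integrable (fun g => (χ g - cbar) ^ 2) (haarProbability G) :=
      (Continuous.integrable_of_hasCompactSupport (by fun_prop) (HasCompactSupport.of_compactSpace _))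
    have hi2 : Integrable (fun g => 2 * (cbar - m) * (χ g - cbar)) (haarProbability G) :=
      (Continuous.integrable_of_hasCompactSupport (by fun_prop) (HasCompactSupport.of_compactSpace _))
    have hi3 : Integrable (fun _ : G => (cbar - m) ^ 2) (haarProbability G) := integrable_const _
    have hexp : (fun g => (χ g - m) ^ 2) =
        fun g => (χ g - cbar) ^ 2 + 2 * (cbar - m) * (χ g - cbar) + (cbar - m) ^ 2 := by
      funext g; ring
    have hlin : ∫ g, (χ g - cbar) ∂haarProbability G = 0 := by
      rw [integral_sub (hχc.integrable_of_hasCompactSupport (HasCompactSupport.of_compactSpace _)) (integrable_const _), integral_const]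
      simp [hcbar]
    have hi12 : Integrable (fun g => (χ g - cbar) ^ 2 + 2 * (cbar - m) * (χ g - cbar))
        (haarProbability G) := hi1.add hi2
    rw [hexp, integral_add hi12 hi3, integral_add hi1 hi2, integral_const_mul, hlin,
      integral_const]
    simp only [probReal_univ, smul_eq_mul, one_mul, mul_zero, add_zero]
    nlinarith [sq_nonneg (cbar - m)]


end Haar

/-! ### Locality of the Wilson action: changing one link moves the action by `O(1)` -/

section Locality

variable {G : Type*} [Group G] [TopologicalSpace G] [IsTopologicalGroup G] [CompactSpace G]
  [MeasurableSpace G] [BorelSpace G]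

omit [MeasurableSpace G] [BorelSpace G] [IsTopologicalGroup G] in
/-- **One-link locality bound**, uniform in the volume: `|S(U) − S(U[e ↦ g])| ≤ B(r)` for all
tori, configurations, links and values (only the `≤ 64` plaquettes through `e` change, each by at
most `2(N + M)`). [folklore] -/
theorem exists_wilsonAction_update_bound (r : LatticeRep G) :
    ∃ B : ℝ, 0 ≤ B ∧ ∀ (L : ℕ) [NeZero L] (U : GaugeConfig 4 L G) (e : Edge 4 L) (g : G),
      |wilsonAction r.ρ U - wilsonAction r.ρ (Function.update U e g)| ≤ B := by
  obtain ⟨M, hM0, hM⟩ := exists_bound_trace_re_nonneg r.ρ r.continuous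
  refine ⟨64 * (2 * ((r.N : ℝ) + M)), by positivity, fun L _ U e g => ?_⟩
  set U' : GaugeConfig 4 L G := Function.update U e g with hU'
  -- per-plaquette cost and its bound
  set c : Plaquette 4 L → GaugeConfig 4 L G → ℝ := fun p V =>
    (r.N : ℝ) - (r.ρ (plaquetteHolonomy V p.1 p.2.1.1 p.2.1.2)).trace.re with hc
  have hcb : ∀ p V, |c p V| ≤ (r.N : ℝ) + M := fun p V => by
    refine (abs_sub _ _).trans ?_
    rw [Nat.abs_cast]
    exact add_le_add le_rfl (hM _)
  have hS : ∀ V : GaugeConfig 4 L G, wilsonAction r.ρ V = ∑ p, c p V := fun V => rfl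
  -- edge sets
  set E : Plaquette 4 L → Finset (Edge 4 L) := fun p =>
    {(p.1, p.2.1.1), (p.1.shift p.2.1.1, p.2.1.2), (p.1.shift p.2.1.2, p.2.1.1), (p.1, p.2.1.2)}
    with hE
  have hoff : ∀ p, e ∉ E p → c p U = c p U' := by
    intro p hp
    have h1 : (p.1, p.2.1.1) ≠ e := fun h => hp (by rw [← h]; simp [hE])
    have h2 : (p.1.shift p.2.1.1, p.2.1.2) ≠ e := fun h => hp (by rw [← h]; simp [hE])
    have h3 : (p.1.shift p.2.1.2, p.2.1.1) ≠ e := fun h => hp (by rw [← h]; simp [hE])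
    have h4 : (p.1, p.2.1.2) ≠ e := fun h => hp (by rw [← h]; simp [hE])
    simp only [hc, hU', plaquetteHolonomy, Function.update_of_ne h1, Function.update_of_ne h2,
      Function.update_of_ne h3, Function.update_of_ne h4]
  -- the plaquettes through `e`
  set T : Finset (Plaquette 4 L) := Finset.univ.filter fun p => e ∈ E p with hT
  have hsum : wilsonAction r.ρ U - wilsonAction r.ρ U' = ∑ p ∈ T, (c p U - c p U') := by
    rw [hS, hS, ← Finset.sum_sub_distrib, hT, Finset.sum_filter_of_ne]
    intro p _ hne
    by_contra hp
    exact hne (by rw [hoff p hp, sub_self])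
  -- `card T ≤ 64`
  have hcard : (T.card : ℝ) ≤ 64 := by
    classical
    set φ : Fin 4 × {q : Fin 4 × Fin 4 // q.1 < q.2} → Plaquette 4 L := fun kq =>
      (![e.1, e.1 - Pi.single kq.2.1.1 1, e.1 - Pi.single kq.2.1.2 1, e.1] kq.1, kq.2) with hφ
    have hsub : T ⊆ Finset.univ.image φ := by
      intro p hp
      have he : e ∈ E p := (Finset.mem_filter.1 hp).2
      simp only [hE, Finset.mem_insert, Finset.mem_singleton] at he
      rcases he with h | h | h | h
      · refine Finset.mem_image.2 ⟨(0, p.2), Finset.mem_univ _, ?_⟩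
        rw [hφ, h]; rfl
      · refine Finset.mem_image.2 ⟨(1, p.2), Finset.mem_univ _, ?_⟩
        rw [hφ, h]
        ext <;> simp [Site.shift]
      · refine Finset.mem_image.2 ⟨(2, p.2), Finset.mem_univ _, ?_⟩
        rw [hφ, h]
        ext <;> simp [Site.shift]
      · refine Finset.mem_image.2 ⟨(3, p.2), Finset.mem_univ _, ?_⟩
        rw [hφ, h]; rfl
    have h1 : T.card ≤ (Finset.univ.image φ).card := Finset.card_le_card hsub
    have h2 : (Finset.univ.image φ).card ≤ Fintype.card (Fin 4 × {q : Fin 4 × Fin 4 // q.1 < q.2}) :=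
      Finset.card_image_le.trans (by rw [Finset.card_univ])
    have h3 : Fintype.card (Fin 4 × {q : Fin 4 × Fin 4 // q.1 < q.2}) ≤ 64 := by
      rw [Fintype.card_prod, Fintype.card_fin]
      have := Fintype.card_subtype_le (fun q : Fin 4 × Fin 4 => q.1 < q.2)
      rw [Fintype.card_prod, Fintype.card_fin] at this
      omega
    exact_mod_cast h1.trans (h2.trans h3)
  -- assemble
  rw [hsum]
  calc |∑ p ∈ T, (c p U - c p U')| ≤ ∑ p ∈ T, |c p U - c p U'| := Finset.abs_sum_le_sum_abs _ _
    _ ≤ ∑ _p ∈ T, 2 * ((r.N : ℝ) + M) := Finset.sum_le_sum fun p _ => by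
        refine (abs_sub _ _).trans ?_
        have := hcb p U; have := hcb p U'
        linarith
    _ = T.card * (2 * ((r.N : ℝ) + M)) := by rw [Finset.sum_const, nsmul_eq_mul]
    _ ≤ 64 * (2 * ((r.N : ℝ) + M)) := by
        refine mul_le_mul_of_nonneg_right hcard ?_
        positivity


omit [MeasurableSpace G] [BorelSpace G] [IsTopologicalGroup G] [CompactSpace G] in
/-- Boltzmann-factor comparison from an action bound. [folklore] -/
theorem exp_mul_le_of_abs_sub_le {β B sX sY : ℝ} (h : |sX - sY| ≤ B) :
    Real.exp (-(|β| * B)) * Real.exp (-β * sY) ≤ Real.exp (-β * sX) := by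
  rw [← Real.exp_add]
  refine Real.exp_le_exp.2 ?_
  have h2 : |β * (sX - sY)| ≤ |β| * B := by
    rw [abs_mul]; exact mul_le_mul_of_nonneg_left h (abs_nonneg _)
  have h3 := (abs_le.1 h2).2
  nlinarith

end Locality

/-! ### The variance floor -/

section Floor

variable {G : Type*} [Group G] [TopologicalSpace G] [IsTopologicalGroup G] [CompactSpace G]
  [MeasurableSpace G] [BorelSpace G]

/-- **Volume-uniform variance floor of the time-zero plaquette trace.** For an admissible `(G, r)`
and a coupling `β` there is `v > 0` such that on EVERY torus `(2S+1)⁴`, `S ≥ 1`, the variance of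
`U ↦ Re tr ρ(U_p)` (`p` the `(1,2)`-plaquette at the origin) under Wilson's measure is at least `v`
(`v = e^{−2|β|B} · Var_Haar`-floor: free one link against the `≤ 64` plaquettes through it, then
left invariance of Haar measure). [folklore] -/
theorem plaquette_variance_floor (hG : IsCompactSimpleLieGroup G) (r : LatticeRep G) (β : ℝ) :
    ∃ v : ℝ, 0 < v ∧ ∀ S : ℕ, 1 ≤ S →
      v ≤ ∫ U, ((r.ρ (plaquetteHolonomy U 0 1 2)).trace.re -
          ∫ V, (r.ρ (plaquetteHolonomy V 0 1 2)).trace.re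
            ∂(wilsonMeasure (d := 4) (L := 2 * S + 1) r.ρ β)) ^ 2
          ∂(wilsonMeasure (d := 4) (L := 2 * S + 1) r.ρ β) := by
  classical
  obtain ⟨σ, hσ, hσle⟩ := exists_haar_sq_sub_ge hG r
  obtain ⟨B, hB0, hB⟩ := exists_wilsonAction_update_bound r
  set e : ℝ := Real.exp (-(|β| * B)) with he
  have he0 : 0 < e := Real.exp_pos _
  refine ⟨e * e * σ, by positivity, fun S hS => ?_⟩
  haveI : Fact (1 < 2 * S + 1) := ⟨by omega⟩
  haveI : SecondCountableTopology G :=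
    (r.continuous.isClosedEmbedding r.injective).isEmbedding.secondCountableTopology
  set μ := wilsonMeasure (d := 4) (L := 2 * S + 1) r.ρ β with hμ
  haveI hprob : IsProbabilityMeasure μ :=
    isProbabilityMeasure_wilsonMeasure (d := 4) (L := 2 * S + 1) r.ρ r.continuous β
  set f : GaugeConfig 4 (2 * S + 1) G → ℝ := fun U => (r.ρ (plaquetteHolonomy U 0 1 2)).trace.re
    with hf
  set m : ℝ := ∫ V, f V ∂μ with hm
  set φ : GaugeConfig 4 (2 * S + 1) G → ℝ := fun U => (f U - m) ^ 2 with hφ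
  show e * e * σ ≤ ∫ U, φ U ∂μ
  set π : Measure (GaugeConfig 4 (2 * S + 1) G) := Measure.pi fun _ => haarProbability G with hπ
  set w : GaugeConfig 4 (2 * S + 1) G → ℝ := fun U => Real.exp (-β * wilsonAction r.ρ U) with hw
  set l : Edge 4 (2 * S + 1) := ((0 : Site 4 (2 * S + 1)), (1 : Fin 4)) with hl
  set w₁ : GaugeConfig 4 (2 * S + 1) G → ℝ := fun U => w (Function.update U l 1) with hw₁
  -- continuity / measurability
  have hfc : Continuous f := continuous_re_trace_plaquette r 0 1 2
  have hfm : Measurable f := hfc.measurable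
  have hφm : Measurable φ := (hfm.sub measurable_const).pow_const 2
  have hφ0 : ∀ U, 0 ≤ φ U := fun U => sq_nonneg _
  have hwm : Measurable w := ((measurable_wilsonAction r.ρ r.continuous).const_mul _).exp
  have hw₁m : Measurable w₁ := hwm.comp measurable_update_left
  have hw0 : ∀ U, 0 ≤ w U := fun U => (Real.exp_pos _).le
  -- Boltzmann comparisons in both directions
  have hcmp1 : ∀ U, e * w₁ U ≤ w U := fun U =>
    exp_mul_le_of_abs_sub_le (hB (2 * S + 1) U l 1)
  have hcmp2 : ∀ U, e * w U ≤ w₁ U := fun U => by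
    have h := hB (2 * S + 1) U l 1
    rw [abs_sub_comm] at h
    exact exp_mul_le_of_abs_sub_le h
  -- the partition function
  set Z : ℝ≥0∞ := partitionFunction (d := 4) (L := 2 * S + 1) r.ρ β with hZ
  have hZeq : Z = ∫⁻ U, ENNReal.ofReal (w U) ∂π := by
    simp only [hZ, partitionFunction, wilsonWeight, withDensity_apply _ MeasurableSet.univ,
      Measure.restrict_univ, hπ, hw]
  have hZ1 : Z⁻¹ * Z = 1 := by
    have h1 : μ Set.univ = 1 := measure_univ
    rw [hμ, wilsonMeasure, Measure.smul_apply, smul_eq_mul] at h1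
    exact h1
  have hZ0 : Z ≠ 0 := fun h => by simp [h] at hZ1
  have hZtop : Z ≠ ⊤ := fun h => by simp [h] at hZ1
  -- the variance as a lintegral against product Haar measure
  have hμπ : μ = Z⁻¹ • π.withDensity (fun U => ENNReal.ofReal (w U)) := by
    simp only [hμ, wilsonMeasure, wilsonWeight, hZ, hπ, hw]
  have hvar : ∫ U, φ U ∂μ = (∫⁻ U, ENNReal.ofReal (φ U) ∂μ).toReal :=
    integral_eq_lintegral_of_nonneg_ae (Eventually.of_forall hφ0) hφm.aestronglyMeasurable
  have hlin : ∫⁻ U, ENNReal.ofReal (φ U) ∂μ =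
      Z⁻¹ * ∫⁻ U, ENNReal.ofReal (w U) * ENNReal.ofReal (φ U) ∂π := by
    rw [hμπ, lintegral_smul_measure, lintegral_withDensity_eq_lintegral_mul _
      hwm.ennreal_ofReal hφm.ennreal_ofReal]
    rfl
  -- finiteness
  obtain ⟨M, -, hM⟩ := exists_bound_trace_re_nonneg r.ρ r.continuous
  have hφb : ∀ U, φ U ≤ (M + |m|) ^ 2 := fun U => by
    have h1 : |f U - m| ≤ M + |m| := (abs_sub _ _).trans (add_le_add (hM _) le_rfl)
    calc φ U = |f U - m| ^ 2 := (sq_abs _).symm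
      _ ≤ (M + |m|) ^ 2 := pow_le_pow_left₀ (abs_nonneg _) h1 2
  have hfin : ∫⁻ U, ENNReal.ofReal (φ U) ∂μ ≠ ⊤ := by
    refine ne_top_of_le_ne_top (b := ∫⁻ _U, ENNReal.ofReal ((M + |m|) ^ 2) ∂μ) ?_ ?_
    · rw [lintegral_const, measure_univ, mul_one]; exact ENNReal.ofReal_ne_top
    · exact lintegral_mono fun U => ENNReal.ofReal_le_ofReal (hφb U)
  -- MAIN CHAIN (product Haar): ∫ w φ ≥ e · (e · Z · σ)
  have hstep1 : ENNReal.ofReal e * ∫⁻ U, ENNReal.ofReal (w₁ U) * ENNReal.ofReal (φ U) ∂π ≤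
      ∫⁻ U, ENNReal.ofReal (w U) * ENNReal.ofReal (φ U) ∂π := by
    rw [← lintegral_const_mul' _ _ ENNReal.ofReal_ne_top]
    refine lintegral_mono fun U => ?_
    rw [← mul_assoc, ← ENNReal.ofReal_mul he0.le]
    exact mul_le_mul_left (ENNReal.ofReal_le_ofReal (hcmp1 U)) _
  -- one-link marginal
  have hkey : ∀ x : GaugeConfig 4 (2 * S + 1) G,
      ENNReal.ofReal (w₁ x) * ENNReal.ofReal σ ≤
        ∫⁻ g, ENNReal.ofReal (w₁ (Function.update x l g)) *
          ENNReal.ofReal (φ (Function.update x l g)) ∂haarProbability G := by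
    intro x
    have hw₁u : ∀ g, w₁ (Function.update x l g) = w₁ x := fun g => by
      simp only [hw₁, Function.update_idem]
    simp_rw [hw₁u]
    rw [lintegral_const_mul' _ _ ENNReal.ofReal_ne_top]
    refine mul_le_mul_right ?_ _
    -- the one-link integral of φ
    set Vx : G := x (Site.shift 0 1, 2) * (x (Site.shift 0 2, 1))⁻¹ * (x (0, 2))⁻¹ with hVx
    have hfu : ∀ g, f (Function.update x l g) = (r.ρ (Vx * g)).trace.re := by
      intro g
      have h2 : ((Site.shift (0 : Site 4 (2 * S + 1)) 1, (2 : Fin 4)) : Edge 4 (2 * S + 1)) ≠ l := by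
        simp [hl, Prod.ext_iff]
      have h3 : ((Site.shift (0 : Site 4 (2 * S + 1)) 2, (1 : Fin 4)) : Edge 4 (2 * S + 1)) ≠ l := by
        intro h
        have := congrArg (fun e : Edge 4 (2 * S + 1) => e.1 2) h
        simp [Site.shift, hl] at this
      have h4 : (((0 : Site 4 (2 * S + 1)), (2 : Fin 4)) : Edge 4 (2 * S + 1)) ≠ l := by
        simp [hl, Prod.ext_iff]
      have hhol : plaquetteHolonomy (Function.update x l g) 0 1 2 = g * Vx := by
        simp only [plaquetteHolonomy, hVx, hl]
        rw [Function.update_self, Function.update_of_ne h2, Function.update_of_ne h3,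
          Function.update_of_ne h4]
        simp only [mul_assoc]
      simp only [hf, hhol, map_mul]
      rw [Matrix.trace_mul_comm]
    have hφu : ∀ g, φ (Function.update x l g) = ((r.ρ (Vx * g)).trace.re - m) ^ 2 := fun g => by
      simp only [hφ, hfu]
    simp_rw [hφu]
    have hcont : Continuous fun g : G => ((r.ρ (Vx * g)).trace.re - m) ^ 2 :=
      (((continuous_trace_re r.ρ r.continuous).comp (continuous_const.mul continuous_id)).sub
        continuous_const).pow 2
    rw [← ofReal_integral_eq_lintegral_ofReal (hcont.integrable_of_hasCompactSupport (HasCompactSupport.of_compactSpace _))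
      (Eventually.of_forall fun g => sq_nonneg _)]
    exact ENNReal.ofReal_le_ofReal (hσle m Vx)
  have hstep2 : ∫⁻ U, ENNReal.ofReal (w₁ U) * ENNReal.ofReal σ ∂π ≤
      ∫⁻ U, ENNReal.ofReal (w₁ U) * ENNReal.ofReal (φ U) ∂π := by
    have hΦm : Measurable fun U => ENNReal.ofReal (w₁ U) * ENNReal.ofReal (φ U) :=
      hw₁m.ennreal_ofReal.mul hφm.ennreal_ofReal
    have hΨm : Measurable fun U => ENNReal.ofReal (w₁ U) * ENNReal.ofReal σ :=
      hw₁m.ennreal_ofReal.mul measurable_const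
    rw [hπ, lintegral_eq_lmarginal_univ (1 : GaugeConfig 4 (2 * S + 1) G),
      lintegral_eq_lmarginal_univ (1 : GaugeConfig 4 (2 * S + 1) G),
      ← Finset.sdiff_union_of_subset (Finset.subset_univ {l}),
      lmarginal_union _ _ hΨm Finset.sdiff_disjoint, lmarginal_union _ _ hΦm Finset.sdiff_disjoint]
    refine lmarginal_mono (fun x => ?_) _
    rw [lmarginal_singleton, lmarginal_singleton]
    have hw₁u : ∀ g, w₁ (Function.update x l g) = w₁ x := fun g => by
      simp only [hw₁, Function.update_idem]
    calc ∫⁻ g, ENNReal.ofReal (w₁ (Function.update x l g)) * ENNReal.ofReal σ ∂haarProbability G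
        = ENNReal.ofReal (w₁ x) * ENNReal.ofReal σ := by
          simp_rw [hw₁u]; rw [lintegral_const, measure_univ, mul_one]
      _ ≤ _ := hkey x
  have hstep3 : ENNReal.ofReal e * Z ≤ ∫⁻ U, ENNReal.ofReal (w₁ U) ∂π := by
    rw [hZeq, ← lintegral_const_mul' _ _ ENNReal.ofReal_ne_top]
    refine lintegral_mono fun U => ?_
    rw [← ENNReal.ofReal_mul he0.le]
    exact ENNReal.ofReal_le_ofReal (hcmp2 U)
  -- assemble in ℝ≥0∞
  have hchain : ENNReal.ofReal e * (ENNReal.ofReal e * Z * ENNReal.ofReal σ) ≤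
      ∫⁻ U, ENNReal.ofReal (w U) * ENNReal.ofReal (φ U) ∂π := by
    refine le_trans ?_ hstep1
    refine mul_le_mul_right ?_ _
    refine le_trans ?_ hstep2
    rw [lintegral_mul_const' _ _ ENNReal.ofReal_ne_top]
    exact mul_le_mul_left hstep3 _
  have hgoal : ENNReal.ofReal (e * e * σ) ≤ ∫⁻ U, ENNReal.ofReal (φ U) ∂μ := by
    rw [hlin]
    calc ENNReal.ofReal (e * e * σ) = Z⁻¹ * (ENNReal.ofReal e * (ENNReal.ofReal e * Z * ENNReal.ofReal σ)) := by
          rw [ENNReal.ofReal_mul (by positivity), ENNReal.ofReal_mul he0.le]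
          calc ENNReal.ofReal e * ENNReal.ofReal e * ENNReal.ofReal σ
              = (Z⁻¹ * Z) * (ENNReal.ofReal e * ENNReal.ofReal e * ENNReal.ofReal σ) := by
                rw [hZ1, one_mul]
            _ = _ := by ring
      _ ≤ _ := mul_le_mul_right hchain _
  rw [hvar]
  exact (ENNReal.ofReal_le_iff_le_toReal hfin).1 hgoal


end Floor

end Summit.QuantumFields.YangMills.Theorems.BrascampLiebVacuumSC.Negative

end
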